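import Literature.AlgebraicGeometry.Motives.HodgeLieCommutantEigenspaces
import HarnessLib

/-!
# No non-zero intertwiner between two eigenspaces of a central Hodge endomorphism, local form for a finite spectrum:
# `Hom_𝔤(W_a, W_b) = 0` for `a ≠ b` among finitely many eigenvalues spanning `V_ℂ` (Moonen–Zarhin 1999, proof of (3.4):
# the `E`-eigenspaces are pairwise non-isomorphic `hg_ℂ`-modules)

Family `hodge`, layer `Literature/AlgebraicGeometry/HodgeTheory` (companion of `Motives/HodgeLieCommutantEigenspaces` (W4),
whose §2 is the quadratic case `V_ℂ = W ⊕ W̄`; here any finite family of eigenvalues, e.g. the `2|ι|` eigenvalues of a CM type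
of `E = ℚ[φ]`). UNCONDITIONAL; theorems only, no definition, no named fact, no `sorry`. Written for the cell `pub-hodgeav-hg6`
(req-37 (A) Q2b, TABLE X ROW 11 = `IV(2,1).kE0`, design note `HOME/jobs/ROW11-Esquare-eng4g8/DESIGN.md`, brick R11-3: the
exclusion of the outer twist `W_{μ̄₂} ≅ W_{μ₁}` once its scalar defect vanishes). HONEST FRAMING of that cell: HC / HC_AV /
HC_CM / H2 NOT proved — linear algebra of Hodge structures.

* **`CMThetaKWeil.linearMap_eigenspace_eq_zero`** — `φ ∈ End_Hdg(V)` commuting with `End_Hdg(V)`, `ev : J → ℂ` injective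
  with `⊕_j ker(φ_ℂ − ev j) = V_ℂ`, `𝔤` admissible (`Θ ∈ 𝔤_ℂ`, commuting with `End_Hdg`): for `a ≠ b` every `ℂ`-linear
  `f : W_{ev a} → W_{ev b}` with `f(X_ℂ w) = X_ℂ f(w)` for all `X ∈ 𝔤` is `0`. Proof: extend `f` by `0` on the other
  eigenspaces (the projector onto `W_{ev a}` along `⊕_{j ≠ a} W_{ev j}`, `Submodule.projectionOnto`); the extension commutes
  with every `X_ℂ` (blockwise) and carries `W_{ev a}` into `W_{ev b}`, so it vanishes on `W_{ev a}` by the commutant theorem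
  in W4's form `CentralEigen.eq_zero_of_forall_commute_of_mapsTo_eigenspace`.
* **`CMThetaKWeil.linearMap_eigenspace_eq_zero_hodgeLie`** — the case `𝔤 = Lie Hg(H)`.

## References
* [MoonenZarhin1999LowDim] B. Moonen, Yu. Zarhin, Math. Ann. 315 (1999), §3, proof of Lemma (3.4).
* [Hazama1983] F. Hazama, Tôhoku Math. J. 35 (1983), §3 (p. 305).
* [Deligne1982HodgeCycles] P. Deligne, LNM 900 (1982), I §3 Prop. 3.4, §4 (p. 30).
-/

noncomputable section

open scoped TensorProduct
open Module

namespace Literature.AlgebraicGeometry.Motives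

namespace HodgeStructure

universe u

variable {V : Type u} [AddCommGroup V] [Module ℚ V] [Module.Finite ℚ V] {n : ℤ}

/-- **`Hom_𝔤(W_a, W_b) = 0` for distinct eigenvalues of a central Hodge endomorphism with finite spectrum spanning `V_ℂ`**
(see the module docstring; proof-term-free intertwining hypothesis as in W4: `f w₁ = X_ℂ (f w)` whenever `w₁ = X_ℂ w`).
[cite: MoonenZarhin1999LowDim, §3 proof of Lemma (3.4)] [cite: Hazama1983, §3 (p. 305)]
[cite: Deligne1982HodgeCycles, I §3 Prop. 3.4] -/
theorem CMThetaKWeil.linearMap_eigenspace_eq_zero {J : Type*} (H : HodgeStructure V n) {φ : Module.End ℚ V}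
    (hφE : φ ∈ H.endAlg) (hφ : ∀ a ∈ H.endAlg, a * φ = φ * a) (ev : J → ℂ) (hev : Function.Injective ev)
    (htop : (⨆ j, Module.End.eigenspace (φ.baseChange ℂ) (ev j)) = ⊤)
    (𝔤 : Submodule ℚ (Module.End ℚ V)) {Θ : Module.End ℂ (ℂ ⊗[ℚ] V)}
    (hΘ : ∀ p, ∀ x ∈ H.piece p (n - p), Θ x = ((2 * p - n : ℤ) : ℂ) • x) (hΘ𝔤 : Θ ∈ spanC 𝔤)
    (hcomm : ∀ X ∈ 𝔤, ∀ c : H.endAlg, X * (c : Module.End ℚ V) = (c : Module.End ℚ V) * X)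
    {a b : J} (hab : a ≠ b)
    (f : Module.End.eigenspace (φ.baseChange ℂ) (ev a) →ₗ[ℂ] Module.End.eigenspace (φ.baseChange ℂ) (ev b))
    (hf : ∀ X ∈ 𝔤, ∀ w w₁ : Module.End.eigenspace (φ.baseChange ℂ) (ev a),
      (w₁ : ℂ ⊗[ℚ] V) = X.baseChange ℂ w → (f w₁ : ℂ ⊗[ℚ] V) = X.baseChange ℂ (f w)) :
    f = 0 := by
  set W : J → Submodule ℂ (ℂ ⊗[ℚ] V) := fun j => Module.End.eigenspace (φ.baseChange ℂ) (ev j) with hWdef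
  have hind : iSupIndep W := (Module.End.eigenspaces_iSupIndep (φ.baseChange ℂ)).comp hev
  -- the complement `C = ⊕_{j ≠ a} W j` of `W a`
  set C : Submodule ℂ (ℂ ⊗[ℚ] V) := ⨆ (j) (_ : j ≠ a), W j with hCdef
  have hCompl : IsCompl (W a) C := by
    refine ⟨iSupIndep_def.1 hind a, codisjoint_iff.2 ?_⟩
    rw [hCdef, ← iSup_split_single W a]
    exact htop
  set P : (ℂ ⊗[ℚ] V) →ₗ[ℂ] ↥(W a) := Submodule.projectionOnto (W a) C hCompl with hPdef
  -- extend `f` by zero: `T = ι_b ∘ f ∘ P`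
  set T : Module.End ℂ (ℂ ⊗[ℚ] V) := (W b).subtype ∘ₗ f ∘ₗ P with hTdef
  have hTw : ∀ w : ↥(W a), T w = f w := fun w => by
    rw [hTdef, LinearMap.comp_apply, LinearMap.comp_apply, hPdef, Submodule.projectionOnto_apply_left,
      Submodule.subtype_apply]
  have hT0 : ∀ j, j ≠ a → ∀ w ∈ W j, T w = 0 := fun j hj w hw => by
    have hwC : w ∈ C := by
      rw [hCdef]
      exact Submodule.mem_iSup_of_mem j (Submodule.mem_iSup_of_mem hj hw)
    rw [hTdef, LinearMap.comp_apply, LinearMap.comp_apply, hPdef, Submodule.projectionOnto_apply_of_mem_right hCompl hwC,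
      map_zero, map_zero]
  have hXW : ∀ X ∈ 𝔤, ∀ j, ∀ w ∈ W j, X.baseChange ℂ w ∈ W j := fun X hX j w hw =>
    UnitaryTheta.apply_mem_eigenspace_of_commute (UnitaryTheta.baseChange_commute H hφE hcomm hX) hw
  -- `T` commutes with every `X_ℂ`, `X ∈ 𝔤`
  have hT : ∀ X ∈ 𝔤, T * X.baseChange ℂ = X.baseChange ℂ * T := by
    intro X hX
    refine LinearMap.ext fun v => ?_
    have hv : v ∈ ⨆ j, W j := by rw [htop]; exact Submodule.mem_top
    refine Submodule.iSup_induction W (motive := fun v => (T * X.baseChange ℂ) v = (X.baseChange ℂ * T) v) hv ?_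
      (by simp only [map_zero]) (fun x y hx hy => by simp only [map_add, hx, hy])
    intro j w hw
    rw [Module.End.mul_apply, Module.End.mul_apply]
    by_cases hja : j = a
    · subst hja
      have h1 := hTw ⟨X.baseChange ℂ w, hXW X hX _ w hw⟩
      have h2 := hTw ⟨w, hw⟩
      simp only at h1 h2
      rw [h1, h2]
      exact hf X hX ⟨w, hw⟩ ⟨X.baseChange ℂ w, hXW X hX _ w hw⟩ rfl
    · rw [hT0 j hja _ (hXW X hX j w hw), hT0 j hja w hw, map_zero]
  have hmaps : ∀ w ∈ W a, T w ∈ W b := fun w hw => by rw [hTw ⟨w, hw⟩]; exact (f ⟨w, hw⟩).2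
  refine LinearMap.ext fun w => Subtype.ext ?_
  rw [LinearMap.zero_apply, Submodule.coe_zero, ← hTw w]
  exact CentralEigen.eq_zero_of_forall_commute_of_mapsTo_eigenspace H 𝔤 hΘ hΘ𝔤 hφ hT (hev.ne hab) hmaps w.2

variable [HodgeTensorFacts.{u, u}]

/-- **`Hom_{Lie Hg}(W_a, W_b) = 0`** for distinct eigenvalues of a central Hodge endomorphism with finite spectrum spanning
`V_ℂ` — the case `𝔤 = Lie Hg(H)` (`Θ ∈ (Lie Hg)_ℂ` by `exists_hodgeTheta`). For `E = End_Hdg(V) = ℚ[φ]` a CM field and the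
`2|ι|` eigenvalues of a CM type this says: the blocks `W_σ` are pairwise non-isomorphic `Lie Hg`-modules.
[cite: MoonenZarhin1999LowDim, §3 proof of Lemma (3.4)] [cite: Hazama1983, §3 (p. 305)] -/
theorem CMThetaKWeil.linearMap_eigenspace_eq_zero_hodgeLie {J : Type*} (H : HodgeStructure V n) {φ : Module.End ℚ V}
    (hφE : φ ∈ H.endAlg) (hφ : ∀ a ∈ H.endAlg, a * φ = φ * a) (ev : J → ℂ) (hev : Function.Injective ev)
    (htop : (⨆ j, Module.End.eigenspace (φ.baseChange ℂ) (ev j)) = ⊤) {a b : J} (hab : a ≠ b)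
    (f : Module.End.eigenspace (φ.baseChange ℂ) (ev a) →ₗ[ℂ] Module.End.eigenspace (φ.baseChange ℂ) (ev b))
    (hf : ∀ X ∈ H.hodgeLie, ∀ w w₁ : Module.End.eigenspace (φ.baseChange ℂ) (ev a),
      (w₁ : ℂ ⊗[ℚ] V) = X.baseChange ℂ w → (f w₁ : ℂ ⊗[ℚ] V) = X.baseChange ℂ (f w)) :
    f = 0 := by
  obtain ⟨Θ, hΘ⟩ := exists_hodgeTheta H
  have hΘ𝔤 : Θ ∈ spanC H.hodgeLie := (hodgeLieC_eq_spanC H) ▸ H.mem_hodgeLieC_of_forall_piece hΘ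
  exact CMThetaKWeil.linearMap_eigenspace_eq_zero H hφE hφ ev hev htop H.hodgeLie hΘ hΘ𝔤
    (fun X hX c => H.commute_of_mem_hodgeLie hX c) hab f hf

end HodgeStructure

end Literature.AlgebraicGeometry.Motives

end
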